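import Summits.CriticalPhenomena.PercolationContinuityZ3.Theorems.PercNearOneGluingNoHeavyLowerTailSunflowerBernsteinPoly
import HarnessLib

/-!
# `NoHeavyLowerTail` (crux stmt-CriticalPhenomena-4575), abstract sunflower cubic: A REFLECTED BERNSTEIN POSITIVITY CHECKER, II
# (the scaled tensor-Bernstein basis, the verified backward transform, and the soundness of the certificate)

Support file (seat `prim-ineq-prove-1` gen 38; `--supports stmt-CriticalPhenomena-4575`).  No `sorry`, no named facts.
Memo: run/shared/lean/prim/prim-ineq-prove-1/FINDING-BERNSTEIN-prove1-g38.md §1, §5.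

A polynomial `P` of degree `≤ d` per variable is nonnegative on `[0,1]^n` as soon as `P = Σ_j B_j ∏_i X_i^{j_i}(1 − X_i)^{d−j_i}`
with integers `B_j ≥ 0`.  This file makes that a Boolean test on the dense polynomials of part I (…SunflowerBernsteinPoly):
* `bern1 d k m`, `sum_bern1` — coefficients of `X^k (1−X)^{d−k}`; `bernBasis d j`, `eval_bernBasis` (nonnegative on the cube);
* `along v M` / `alongA` — an integer `(d+1)×(d+1)` matrix applied along one coordinate (function / table form); `fwdM`,
  `bernCoeffsA` — the FORWARD transform, one variable at a time (it only PROPOSES the certificate; its correctness is never used);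
* `evalB S` — mixed evaluation (scaled Bernstein basis on the coordinates in `S`, monomials elsewhere), `evalB_empty`,
  **`evalB_along`** (one backward step along `v ∉ S` is exact: the involution `(e,k) ↦ (e[v↦k], e v)`), `evalB_univ_nonneg`,
  `backL` / `backLA` (`ofTable_backLA`), **`eval_backLA : eval (ofTable (backLA … B)) = evalB univ (ofTable B)`**;
* **`certifyA n d A`** `:= (∀ j, 0 ≤ B j) ∧ (backward transform of B = A)` with `B := bernCoeffsA n d A` (tables compared as
  coefficient functions) and **`eval_nonneg_of_certifyA`**: `certifyA n d A = true → 0 ≤ eval (ofTable n d A) x` on the cube.  Cost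
  `O(n (d+1)^{n+1})` integer operations per transform; meant for `native_decide` (`--computational` check files).
-/

namespace Summit.CriticalPhenomena.PercolationContinuityZ3.Theorems.SunflowerPartition

namespace SafeCalc

namespace Bern

open Finset

variable {n d a b : ℕ}

/-! ## The scaled tensor-Bernstein basis -/

/-- Coefficient of `X^m` in `X^k (1 − X)^(d − k)`. [this work] -/
def bern1 (d k m : ℕ) : ℤ :=
  if k ≤ m ∧ m ≤ d then (Nat.choose (d - k) (m - k) : ℤ) * (-1) ^ (m - k) else 0

/-- `Σ_{m ≤ d} bern1 d k m · t^m = t^k (1 − t)^(d − k)` for `k ≤ d`. [this work] -/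
theorem sum_bern1 (d k : ℕ) (hk : k ≤ d) (t : ℝ) :
    ∑ m : Fin (d + 1), (bern1 d k m : ℝ) * t ^ (m : ℕ) = t ^ k * (1 - t) ^ (d - k) := by
  have hbin : (1 - t) ^ (d - k) = ∑ i ∈ range (d - k + 1), ((Nat.choose (d - k) i : ℝ) * (-1) ^ i) * t ^ i := by
    rw [sub_eq_neg_add, add_pow]
    refine sum_congr rfl fun i _ => ?_
    rw [one_pow, mul_one, neg_pow t i]; ring
  rw [hbin, mul_sum]
  rw [Fin.sum_univ_eq_sum_range (fun m => (bern1 d k m : ℝ) * t ^ m) (d + 1)]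
  rw [Finset.range_eq_Ico, ← Finset.sum_Ico_consecutive _ (Nat.zero_le k) (by omega : k ≤ d + 1)]
  have hz : ∑ m ∈ Ico 0 k, (bern1 d k m : ℝ) * t ^ m = 0 := by
    refine sum_eq_zero fun m hm => ?_
    rw [mem_Ico] at hm
    simp [bern1, show ¬(k ≤ m) by omega]
  rw [hz, zero_add, Finset.sum_Ico_eq_sum_range, show d + 1 - k = d - k + 1 by omega]
  refine sum_congr rfl fun i hi => ?_
  rw [mem_range] at hi
  have h1 : k ≤ k + i := Nat.le_add_right k i
  have h2 : k + i ≤ d := by omega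
  simp only [bern1, h1, h2, and_self, if_true, Nat.add_sub_cancel_left, Int.cast_mul, Int.cast_natCast,
    Int.cast_pow, Int.cast_neg, Int.cast_one, pow_add]
  ring

/-- The scaled tensor-Bernstein basis element `∏_i X_i^{j_i} (1 − X_i)^{d − j_i}` as a dense polynomial. [this work] -/
def bernBasis (d : ℕ) (j : Expo n d) : Poly n d := fun e => ∏ i, bern1 d (j i) (e i)

/-- Evaluation of a basis element. [this work] -/
theorem eval_bernBasis (j : Expo n d) (x : Fin n → ℝ) :
    eval (bernBasis d j) x = ∏ i, (x i) ^ (j i : ℕ) * (1 - x i) ^ (d - j i) := by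
  classical
  simp only [eval, bernBasis, mono, Int.cast_prod, ← prod_mul_distrib]
  rw [← Fintype.piFinset_univ, ← Finset.prod_univ_sum (fun _ => (univ : Finset (Fin (d + 1))))
    (fun i (m : Fin (d + 1)) => (bern1 d (j i) m : ℝ) * x i ^ (m : ℕ))]
  refine prod_congr rfl fun i _ => sum_bern1 d (j i) (Nat.le_of_lt_succ (j i).2) (x i)

/-- Basis elements are nonnegative on the cube. [this work] -/
theorem eval_bernBasis_nonneg (j : Expo n d) {x : Fin n → ℝ} (hx : ∀ i, 0 ≤ x i ∧ x i ≤ 1) :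
    0 ≤ eval (bernBasis d j) x := by
  rw [eval_bernBasis]
  exact prod_nonneg fun i _ => mul_nonneg (pow_nonneg (hx i).1 _) (pow_nonneg (sub_nonneg.2 (hx i).2) _)

/-- Apply an integer `(d+1)×(d+1)` matrix along the coordinate `v`: new coefficient at `e` is `Σ_k M k (e v) · P(e[v ↦ k])`.
[this work] -/
def along (v : Fin n) (M : Fin (d + 1) → Fin (d + 1) → ℤ) (P : Poly n d) : Poly n d :=
  fun e => ∑ k : Fin (d + 1), M k (e v) * P (Function.update e v k)

/-- The same on coefficient tables. [this work] -/
def alongA (n d : ℕ) (v : Fin n) (M : Fin (d + 1) → Fin (d + 1) → ℤ) (A : Array ℤ) : Array ℤ :=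
  tabulate (along v M (ofTable n d A))

/-- The forward one-variable matrix `C(d − k, m − k)` (monomial index `k` ↦ scaled Bernstein index `m`). [this work] -/
def fwdM (d : ℕ) (k m : Fin (d + 1)) : ℤ := if (k : ℕ) ≤ (m : ℕ) then (Nat.choose (d - k) (m - k) : ℤ) else 0

/-- The forward transform (PROPOSES the certificate; its correctness is never used): scaled tensor-Bernstein coefficients,
computed one variable at a time. [this work] -/
def bernCoeffsA (n d : ℕ) (A : Array ℤ) : Array ℤ :=
  (List.finRange n).foldl (fun B v => alongA n d v (fwdM d) B) A

/-! ### The verified backward transform (mixed Bernstein/monomial evaluation) -/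

/-- Per-coordinate basis factor: scaled Bernstein `x^m (1−x)^{d−m}` on the processed coordinates `S`, monomial `x^m` elsewhere.
[this work] -/
def phiB (S : Finset (Fin n)) (x : Fin n → ℝ) (i : Fin n) (m : Fin (d + 1)) : ℝ :=
  if i ∈ S then x i ^ (m : ℕ) * (1 - x i) ^ (d - m) else x i ^ (m : ℕ)

/-- Mixed evaluation: Bernstein basis in the coordinates of `S`, monomials in the others. [this work] -/
def evalB (S : Finset (Fin n)) (P : Poly n d) (x : Fin n → ℝ) : ℝ := ∑ e, (P e : ℝ) * ∏ i, phiB (d := d) S x i (e i)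

/-- With no processed coordinate the mixed evaluation is the ordinary one. [this work] -/
theorem evalB_empty (P : Poly n d) (x : Fin n → ℝ) : evalB ∅ P x = eval P x := by
  simp only [evalB, eval, mono, phiB, Finset.notMem_empty, if_false]

/-- One backward step along `v ∉ S`: applying the matrix `bern1` along `v` trades the Bernstein factor of `v` for monomials.
[this work] -/
theorem evalB_along (S : Finset (Fin n)) {v : Fin n} (hv : v ∉ S) (P : Poly n d) (x : Fin n → ℝ) :
    evalB S (along v (fun k m => bern1 d k m) P) x = evalB (insert v S) P x := by
  classical
  unfold evalB along
  -- expand the inner sum and view both sides as sums over `Expo × Fin (d+1)`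
  have lhs : ∑ e : Expo n d, ((∑ k : Fin (d + 1), bern1 d k (e v) * P (Function.update e v k) : ℤ) : ℝ) *
        ∏ i, phiB (d := d) S x i (e i) =
      ∑ q : Expo n d × Fin (d + 1), (bern1 d q.2 (q.1 v) : ℝ) * P (Function.update q.1 v q.2) *
        ∏ i, phiB (d := d) S x i (q.1 i) := by
    rw [Fintype.sum_prod_type]
    refine sum_congr rfl fun e _ => ?_
    rw [Int.cast_sum, sum_mul]
    refine sum_congr rfl fun k _ => ?_
    push_cast; ring
  have rhs : ∑ e : Expo n d, (P e : ℝ) * ∏ i, phiB (d := d) (insert v S) x i (e i) =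
      ∑ q : Expo n d × Fin (d + 1), (P q.1 : ℝ) * ((bern1 d (q.1 v) q.2 : ℝ) * x v ^ (q.2 : ℕ)) *
        ∏ i ∈ univ.erase v, phiB (d := d) S x i (q.1 i) := by
    rw [Fintype.sum_prod_type]
    refine sum_congr rfl fun e _ => ?_
    rw [← Finset.mul_prod_erase univ _ (mem_univ v)]
    have hB : phiB (d := d) (insert v S) x v (e v) = ∑ m : Fin (d + 1), (bern1 d (e v) m : ℝ) * x v ^ (m : ℕ) := by
      rw [phiB, if_pos (mem_insert_self v S), sum_bern1 d (e v) (Nat.le_of_lt_succ (e v).2)]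
    have hrest : ∏ i ∈ univ.erase v, phiB (d := d) (insert v S) x i (e i) = ∏ i ∈ univ.erase v, phiB (d := d) S x i (e i) := by
      refine prod_congr rfl fun i hi => ?_
      have hiv : i ≠ v := ne_of_mem_erase hi
      simp only [phiB, mem_insert, hiv, false_or]
    rw [hB, hrest, sum_mul, mul_sum]
    refine sum_congr rfl fun m _ => by ring
  rw [lhs, rhs]
  -- reindex the left sum by the involution `(e, k) ↦ (e[v ↦ k], e v)`
  let σ : Expo n d × Fin (d + 1) → Expo n d × Fin (d + 1) := fun q => (Function.update q.1 v q.2, q.1 v)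
  have hσ : ∀ q, σ (σ q) = q := by
    intro q
    simp only [σ, Function.update_self, Function.update_idem, Function.update_eq_self]
  let τ : Expo n d × Fin (d + 1) ≃ Expo n d × Fin (d + 1) :=
    { toFun := σ, invFun := σ, left_inv := hσ, right_inv := hσ }
  refine (Fintype.sum_equiv τ _ _ fun q => ?_).symm
  -- term-by-term: q = (e, m) on the right corresponds to σ q = (e[v↦m], e v) on the left
  show (P q.1 : ℝ) * ((bern1 d (q.1 v) q.2 : ℝ) * x v ^ (q.2 : ℕ)) * ∏ i ∈ univ.erase v, phiB (d := d) S x i (q.1 i) =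
    (bern1 d (σ q).2 ((σ q).1 v) : ℝ) * P (Function.update (σ q).1 v (σ q).2) *
      ∏ i, phiB (d := d) S x i ((σ q).1 i)
  simp only [σ, Function.update_self, Function.update_idem, Function.update_eq_self]
  rw [← Finset.mul_prod_erase univ _ (mem_univ v)]
  have hv' : phiB (d := d) S x v (Function.update q.1 v q.2 v) = x v ^ (q.2 : ℕ) := by
    rw [Function.update_self, phiB, if_neg hv]
  have hrest : ∏ i ∈ univ.erase v, phiB (d := d) S x i (Function.update q.1 v q.2 i) =
      ∏ i ∈ univ.erase v, phiB (d := d) S x i (q.1 i) := by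
    refine prod_congr rfl fun i hi => ?_
    rw [Function.update_of_ne (ne_of_mem_erase hi)]
  rw [hv', hrest]
  ring

/-- Full Bernstein evaluation of nonnegative coefficients is nonnegative on the cube. [this work] -/
theorem evalB_univ_nonneg {B : Poly n d} (hB : ∀ j, 0 ≤ B j) {x : Fin n → ℝ} (hx : ∀ i, 0 ≤ x i ∧ x i ≤ 1) :
    0 ≤ evalB univ B x := by
  refine sum_nonneg fun e _ => mul_nonneg (by exact_mod_cast hB e) (prod_nonneg fun i _ => ?_)
  simp only [phiB, mem_univ, if_true]
  exact mul_nonneg (pow_nonneg (hx i).1 _) (pow_nonneg (sub_nonneg.2 (hx i).2) _)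

/-- The backward transform along a list of distinct coordinates. [this work] -/
def backL : List (Fin n) → Poly n d → Poly n d
  | [], P => P
  | v :: l, P => backL l (along v (fun k m => bern1 d k m) P)

/-- The same on coefficient tables (each stage tabulated). [this work] -/
def backLA (n d : ℕ) : List (Fin n) → Array ℤ → Array ℤ
  | [], A => A
  | v :: l, A => backLA n d l (alongA n d v (fun k m => bern1 d k m) A)

/-- The table version computes the backward transform. [this work] -/
theorem ofTable_backLA : ∀ (l : List (Fin n)) (A : Array ℤ), ofTable n d (backLA n d l A) = backL l (ofTable n d A)
  | [], A => rfl
  | v :: l, A => by rw [backLA, backL, ofTable_backLA l, alongA, ofTable_tabulate]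

/-- Backward steps along a list of fresh distinct coordinates process all of them. [this work] -/
theorem evalB_backL : ∀ (l : List (Fin n)) (S : Finset (Fin n)), l.Nodup → (∀ v ∈ l, v ∉ S) → ∀ (P : Poly n d) (x : Fin n → ℝ),
    evalB S (backL l P) x = evalB (S ∪ l.toFinset) P x
  | [], S, _, _, P, x => by simp [backL]
  | v :: l, S, hnd, hdis, P, x => by
    have hvl : v ∉ l := (List.nodup_cons.1 hnd).1
    have hvS : v ∉ S := hdis v (List.mem_cons_self ..)
    rw [backL, evalB_backL l S (List.nodup_cons.1 hnd).2 (fun w hw => hdis w (List.mem_cons_of_mem v hw))]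
    have hv' : v ∉ S ∪ l.toFinset := by
      rw [mem_union, List.mem_toFinset]; exact fun h => h.elim hvS hvl
    rw [evalB_along _ hv', List.toFinset_cons, Finset.union_insert]

/-- Full backward transform of a coefficient table. [this work] -/
theorem eval_backLA (B : Array ℤ) (x : Fin n → ℝ) :
    eval (ofTable n d (backLA n d (List.finRange n) B)) x = evalB univ (ofTable n d B) x := by
  rw [ofTable_backLA, ← evalB_empty, evalB_backL (List.finRange n) ∅ (List.nodup_finRange n) (fun v _ => notMem_empty v),
    List.toFinset_finRange, Finset.empty_union]

/-- **The certificate** (on a coefficient table `A` of a polynomial of degree `≤ d` in each of `n` variables): the proposed scaled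
Bernstein coefficients are all nonnegative and transform back to `A` exactly. [this work] -/
def certifyA (n d : ℕ) (A : Array ℤ) : Bool :=
  let B := bernCoeffsA n d A
  decide (∀ j : Expo n d, 0 ≤ ofTable n d B j) && decide (ofTable n d (backLA n d (List.finRange n) B) = ofTable n d A)

/-- **Soundness of the certificate**: a certified table is (the table of) a polynomial nonnegative on the unit cube. [this work] -/
theorem eval_nonneg_of_certifyA {A : Array ℤ} (h : certifyA n d A = true) {x : Fin n → ℝ}
    (hx : ∀ i, 0 ≤ x i ∧ x i ≤ 1) : 0 ≤ eval (ofTable n d A) x := by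
  simp only [certifyA, Bool.and_eq_true, decide_eq_true_eq] at h
  rw [← h.2, eval_backLA]
  exact evalB_univ_nonneg h.1 hx


end Bern

end SafeCalc

end Summit.CriticalPhenomena.PercolationContinuityZ3.Theorems.SunflowerPartition
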